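import Summits.RiemannHypothesis.RiemannHypothesis.Theses.SignCone
import Summits.RiemannHypothesis.RiemannHypothesis.Theorems.SignConeOscillatory.Negative.WithoutPD
import Summits.RiemannHypothesis.RiemannHypothesis.Theorems.SignConeOscillatory.Negative.WithoutPDOriginDominating
import Summits.RiemannHypothesis.RiemannHypothesis.Theorems.SignConeSignConeOscillatoryIffInequality
import Literature.NumberTheory.LFunctions.WeilMarkovQuadratic

/-!
# `OscCoherentCore` (crux stmt-RiemannHypothesis-18013) — negative lemma: positive-definiteness stays load-bearing on
# the coherent-core class, even with origin domination
(route `SignCone`; refuter crux-attack record of the standing disprover, `--supports` — it closes nothing)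

The crux `Summit.RiemannHypothesis.RiemannHypothesis.Theses.SignCone.OscCoherentCore` asserts the unit-slack
sign-cone inequality `-Re F(0) ≤ Re W_ar(F)` for node-nonnegative AUTOCORRELATION SUMS `F = Σᵢ gᵢ ⋆ g̃ᵢ`
(`supp gᵢ ⊆ [-a, a]`, `a > 13/10`) whose far-field negativity is not confined to a single window
`T ≤ |t| ≤ T + log 2`, `T ≥ 3`. The parent crux `SignConeOscillatory` (to which the core is EQUIVALENT,
`SignCone.oscCoherentCore_iff_signConeOscillatory`) was shown to need the cone structure of `F`:
`SignConeOscillatory.Negative.signConeOscillatory_false_without_PD` (p130023) and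
`…_false_without_PD_originDominating` (the mutated statements over "smooth, compactly supported in `[-2a, 2a]`,
hermitian [and origin-dominating `‖F u‖ ≤ Re F(0)`]" functions are false). Here the same is proved INSIDE the
coherent-core class, by transfer rather than by a new computation:

* `withoutPD_originDominating_transfer` — the core-class mutated statement (cutoff guard `13/10 < a`, the class
  restriction "not a single window", origin domination, hermitian symmetry, node signs, oscillation) IMPLIES the
  parent's mutated statement: given any admissible `F` at cutoff `a`, the functions
  `F + η² (w₁ ⋆ w̃₁) + η² (w₂ ⋆ w̃₂)` (`wⱼ` vanishing two-bump tests in node gaps at heights `2a < c₁`,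
  `c₁ + log 2 < c₂`, `SignCone.exists_gap_parameters`) are admissible at the cutoff `c₂/2 + ρ₂ > 13/10`, still
  hermitian, origin-dominating (`‖g ⋆ g̃‖ ≤ (g ⋆ g̃)(0)`, `norm_weilConv_weilReflect_le`) and node-nonnegative,
  and negative at `c₁` and at `c₂` — two heights more than `log 2` apart, so in NO single window; linearity of
  `W_ar = weilPolarTerm + weilArchTerm` and `η → 0` return the inequality for `F` itself
  (the collapse pattern of `SignCone.signConeInequality_of_oscCoherentCore`, run on the hermitian class);
* `oscCoherentCore_false_without_PD_originDominating` — hence the core-class statement over hermitian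
  origin-dominating smooth compactly supported `F` is FALSE (parent witness: the plateau comb at `a = 11/10`);
* `oscCoherentCore_false_without_PD` — and a fortiori so is the statement without origin domination
  (parent witness: `F = -(φ(· - 9/10) + φ(· + 9/10))`, `φ = moll 11`, `a = 1`).

Reading for provers: the class restriction of the core does not interact with positive-definiteness either; as for
the parent, hermitian symmetry + `|F| ≤ F(0)` + node signs + oscillation do not control the polar term, and a
proof must use `F̂ ≥ 0` against the node train.
-/

noncomputable section

-- `Summit.RiemannHypothesis.RiemannHypothesis.…` repeats a namespace component by design (D-0017 layout).
set_option linter.dupNamespace false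

open scoped BigOperators ComplexConjugate Topology
open Complex MeasureTheory Set Filter

namespace Summit.RiemannHypothesis.RiemannHypothesis.Theorems.OscCoherentCore.Negative

open Literature.NumberTheory.LFunctions
open Summit.RiemannHypothesis.RiemannHypothesis.Theorems.SignCone
open Summit.RiemannHypothesis.RiemannHypothesis.Theorems.SignConeOscillatory.Negative

/-! ## Two-bump autocorrelations are origin-dominating -/

/-- `‖G u‖ ≤ Re G(0)` for an autocorrelation `G = w ⋆ w̃` of a Weil test. [folklore] -/
theorem norm_weilConv_weilReflect_le_re_zero {w : ℝ → ℂ} (hw : IsWeilTest w) (u : ℝ) :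
    ‖weilConv w (weilReflect w) u‖ ≤ (weilConv w (weilReflect w) 0).re := by
  rw [weilConv_weilReflect_apply_zero, Complex.ofReal_re]
  exact norm_weilConv_weilReflect_le hw u

/-! ## The transfer -/

/-- **Transfer to the parent class.** The mutated core statement — "for `a > 13/10` and every smooth `F` compactly
supported in `[-2a, 2a]`, hermitian, origin-dominating, node-nonnegative, whose far-field negativity is NOT
confined to a single window `[T, T + log 2]` (`T ≥ 3`) but exists, `-Re F(0) ≤ Re W_ar(F)`" — implies the same
statement WITHOUT the cutoff guard and WITHOUT the class restriction (the parent's mutated statement of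
`signConeOscillatory_false_without_PD_originDominating`): append `η² (w₁ ⋆ w̃₁) + η² (w₂ ⋆ w̃₂)` in node gaps beyond
the support and let `η → 0`. [folklore] -/
theorem withoutPD_originDominating_transfer
    (h : ∀ a : ℝ, 0 < a → 13 / 10 < a → ∀ F : ℝ → ℂ,
      (ContDiff ℝ ((⊤ : ℕ∞) : WithTop ℕ∞) F ∧ HasCompactSupport F) ∧ tsupport F ⊆ Set.Icc (-(2 * a)) (2 * a) →
      (∀ u : ℝ, F (-u) = (starRingEnd ℂ) (F u)) → (∀ u : ℝ, ‖F u‖ ≤ (F 0).re) →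
      (∀ n : ℕ, 2 ≤ n → 0 ≤ (F (Real.log n)).re) →
      ¬ (∃ T : ℝ, 3 ≤ T ∧ ∀ t : ℝ, Real.log 2 ≤ |t| → (F t).re < 0 → T ≤ |t| ∧ |t| ≤ T + Real.log 2) →
      (∃ t : ℝ, Real.log 2 ≤ |t| ∧ (F t).re < 0) →
      let M : ℂ → ℂ := fun s => ∫ u : ℝ, F u * Complex.exp ((s - 1 / 2) * u);
      -(F 0).re ≤ (M 0 + M 1 + ((1 / (2 * Real.pi) : ℂ) * (∫ t : ℝ, M (1 / 2 + t * Complex.I) *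
        ((Complex.digamma (1 / 4 + t / 2 * Complex.I)).re : ℂ)) - F 0 * (Real.log Real.pi : ℂ))).re) :
    ∀ a : ℝ, 0 < a → ∀ F : ℝ → ℂ,
      (ContDiff ℝ ((⊤ : ℕ∞) : WithTop ℕ∞) F ∧ HasCompactSupport F) ∧ tsupport F ⊆ Set.Icc (-(2 * a)) (2 * a) →
      (∀ u : ℝ, F (-u) = (starRingEnd ℂ) (F u)) → (∀ u : ℝ, ‖F u‖ ≤ (F 0).re) →
      (∀ n : ℕ, 2 ≤ n → 0 ≤ (F (Real.log n)).re) → (∃ t : ℝ, Real.log 2 ≤ |t| ∧ (F t).re < 0) →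
      let M : ℂ → ℂ := fun s => ∫ u : ℝ, F u * Complex.exp ((s - 1 / 2) * u);
      -(F 0).re ≤ (M 0 + M 1 + ((1 / (2 * Real.pi) : ℂ) * (∫ t : ℝ, M (1 / 2 + t * Complex.I) *
        ((Complex.digamma (1 / 4 + t / 2 * Complex.I)).re : ℂ)) - F 0 * (Real.log Real.pi : ℂ))).re := by
  intro a ha F hF hherm hdom hn _hosc
  show -(F 0).re ≤ (weilPolarTerm F + weilArchTerm F).re
  have hFt : IsWeilTest F := hF.1
  -- first gap witness, beyond `2a`
  obtain ⟨N₁, c₁, hc₁a, hc₁2, hρc₁, hnode₁, hlogm₁⟩ := exists_gap_parameters ha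
  have hρ₁ := (WeilContinuous.bump N₁).rOut_pos
  set ρ₁ := (WeilContinuous.bump N₁).rOut with hρ₁def
  have hc₁0 : 0 ≤ c₁ := by linarith
  set w₁ : ℝ → ℂ := fun u => WeilContinuous.moll N₁ (u + c₁ / 2) - WeilContinuous.moll N₁ (u - c₁ / 2)
    with hw₁def
  set G₁ : ℝ → ℂ := weilConv w₁ (weilReflect w₁) with hG₁def
  have hw₁t : IsWeilTest w₁ := isWeilTest_twoBump N₁ c₁
  have hw₁supp : tsupport w₁ ⊆ Icc (-(c₁ / 2 + ρ₁)) (c₁ / 2 + ρ₁) := tsupport_twoBump_subset N₁ hc₁0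
  have hG₁t : IsWeilTest G₁ := hw₁t.weilConv hw₁t.weilReflect
  have hG₁supp : tsupport G₁ ⊆ Icc (-(2 * (c₁ / 2 + ρ₁))) (2 * (c₁ / 2 + ρ₁)) :=
    tsupport_weilConv_weilReflect_subset hw₁t.2 hw₁supp
  have hG₁node : ∀ m : ℕ, 2 ≤ m → G₁ (Real.log m) = 0 := fun m hm =>
    weilConv_twoBump_eq_zero N₁ hc₁0 (hlogm₁ m hm) (hnode₁ m hm)
  have hG₁c₁ : (G₁ c₁).re < 0 := re_weilConv_twoBump_neg N₁ hρc₁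
  have hG₁herm : ∀ u : ℝ, G₁ (-u) = conj (G₁ u) := fun u => weilConv_weilReflect_neg w₁ u
  -- second gap witness, beyond `c₁ + 2ρ₁ + log 2 + 13/5`
  set a₂ : ℝ := (c₁ + 2 * ρ₁ + Real.log 2) / 2 + 13 / 10 with ha₂def
  have hlog2 : 0 < Real.log 2 := Real.log_pos (by norm_num)
  have ha₂ : 0 < a₂ := by rw [ha₂def]; positivity
  obtain ⟨N₂, c₂, hc₂a, hc₂2, hρc₂, hnode₂, hlogm₂⟩ := exists_gap_parameters ha₂
  have hρ₂ := (WeilContinuous.bump N₂).rOut_pos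
  set ρ₂ := (WeilContinuous.bump N₂).rOut with hρ₂def
  have hc₂0 : 0 ≤ c₂ := by linarith
  have hc₁c₂ : c₁ + 2 * ρ₁ + Real.log 2 + 13 / 5 < c₂ := by rw [ha₂def] at hc₂a; linarith
  have hρ₂2 : 2 * ρ₂ ≤ Real.log 2 := by
    have := hlogm₂ 2 le_rfl
    push_cast at this
    exact this
  set w₂ : ℝ → ℂ := fun u => WeilContinuous.moll N₂ (u + c₂ / 2) - WeilContinuous.moll N₂ (u - c₂ / 2)
    with hw₂def
  set G₂ : ℝ → ℂ := weilConv w₂ (weilReflect w₂) with hG₂def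
  have hw₂t : IsWeilTest w₂ := isWeilTest_twoBump N₂ c₂
  have hw₂supp : tsupport w₂ ⊆ Icc (-(c₂ / 2 + ρ₂)) (c₂ / 2 + ρ₂) := tsupport_twoBump_subset N₂ hc₂0
  have hG₂t : IsWeilTest G₂ := hw₂t.weilConv hw₂t.weilReflect
  have hG₂supp : tsupport G₂ ⊆ Icc (-(2 * (c₂ / 2 + ρ₂))) (2 * (c₂ / 2 + ρ₂)) :=
    tsupport_weilConv_weilReflect_subset hw₂t.2 hw₂supp
  have hG₂node : ∀ m : ℕ, 2 ≤ m → G₂ (Real.log m) = 0 := fun m hm =>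
    weilConv_twoBump_eq_zero N₂ hc₂0 (hlogm₂ m hm) (hnode₂ m hm)
  have hG₂c₂ : (G₂ c₂).re < 0 := re_weilConv_twoBump_neg N₂ hρc₂
  have hG₂herm : ∀ u : ℝ, G₂ (-u) = conj (G₂ u) := fun u => weilConv_weilReflect_neg w₂ u
  -- cross vanishing: `G₁ c₂ = 0`, `G₂ c₁ = 0`
  have hG₁c₂ : G₁ c₂ = 0 := by
    refine weilConv_twoBump_eq_zero N₁ hc₁0 (by linarith) ?_
    rw [abs_of_nonneg (by linarith)]
    linarith
  have hG₂c₁ : G₂ c₁ = 0 := by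
    refine weilConv_twoBump_eq_zero N₂ hc₂0 (by linarith) ?_
    rw [abs_of_nonpos (by linarith)]
    linarith
  -- `F` vanishes at `c₁, c₂ > 2a`
  have hFzero : ∀ c : ℝ, 2 * a < c → F c = 0 := by
    intro c hc
    refine image_eq_zero_of_notMem_tsupport fun hmem => ?_
    have := hF.2 hmem
    rw [mem_Icc] at this
    linarith [this.2]
  have hFc₁ : F c₁ = 0 := hFzero c₁ hc₁a
  have hFc₂ : F c₂ = 0 := hFzero c₂ (by linarith)
  -- the key inequality for every `η > 0`
  have key : ∀ η : ℝ, 0 < η →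
      -(F 0).re ≤ (weilPolarTerm F + weilArchTerm F).re +
        η ^ 2 * ((weilPolarTerm G₁ + weilArchTerm G₁).re + (G₁ 0).re +
          ((weilPolarTerm G₂ + weilArchTerm G₂).re + (G₂ 0).re)) := by
    intro η hη
    set a' : ℝ := c₂ / 2 + ρ₂ with ha'def
    have ha' : 0 < a' := by rw [ha'def]; linarith
    have ha'13 : 13 / 10 < a' := by rw [ha'def]; linarith
    have haa' : a ≤ a' := by rw [ha'def]; linarith
    set m : ℂ := ((η ^ 2 : ℝ) : ℂ) with hmdef
    have hmconj : conj m = m := by rw [hmdef, Complex.conj_ofReal]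
    -- the perturbed function `F₂ = (F + m G₁) + m G₂`
    set F₁ : ℝ → ℂ := fun t => F t + m * G₁ t with hF₁def
    set F₂ : ℝ → ℂ := fun t => F₁ t + m * G₂ t with hF₂def
    have hF₁t : IsWeilTest F₁ := hFt.add (hG₁t.const_mul m)
    have hF₂t : IsWeilTest F₂ := hF₁t.add (hG₂t.const_mul m)
    -- support in `[-2a', 2a']`
    have hIcc₀ : Icc (-(2 * a)) (2 * a) ⊆ Icc (-(2 * a')) (2 * a') := Icc_subset_Icc (by linarith) (by linarith)
    have hIcc₁ : Icc (-(2 * (c₁ / 2 + ρ₁))) (2 * (c₁ / 2 + ρ₁)) ⊆ Icc (-(2 * a')) (2 * a') :=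
      Icc_subset_Icc (by rw [ha'def]; linarith) (by rw [ha'def]; linarith)
    have hIcc₂ : Icc (-(2 * (c₂ / 2 + ρ₂))) (2 * (c₂ / 2 + ρ₂)) ⊆ Icc (-(2 * a')) (2 * a') :=
      Icc_subset_Icc (by rw [ha'def]) (by rw [ha'def])
    have hF₁supp : tsupport F₁ ⊆ Icc (-(2 * a')) (2 * a') := by
      have e : F₁ = F + fun t => m * G₁ t := rfl
      rw [e]
      refine (tsupport_add _ _).trans (union_subset (hF.2.trans hIcc₀) ?_)
      exact tsupport_mul_subset_right.trans (hG₁supp.trans hIcc₁)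
    have hF₂supp : tsupport F₂ ⊆ Icc (-(2 * a')) (2 * a') := by
      have e : F₂ = F₁ + fun t => m * G₂ t := rfl
      rw [e]
      refine (tsupport_add _ _).trans (union_subset hF₁supp ?_)
      exact tsupport_mul_subset_right.trans (hG₂supp.trans hIcc₂)
    -- hermitian
    have hherm₂ : ∀ u : ℝ, F₂ (-u) = (starRingEnd ℂ) (F₂ u) := by
      intro u
      simp only [hF₂def, hF₁def, map_add, map_mul, hmconj, hG₁herm, hG₂herm, hherm]
    -- origin domination
    have hF₂0 : (F₂ 0).re = (F 0).re + η ^ 2 * (G₁ 0).re + η ^ 2 * (G₂ 0).re := by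
      simp only [hF₂def, hF₁def, hmdef, Complex.add_re, Complex.re_ofReal_mul]
    have hdom₂ : ∀ u : ℝ, ‖F₂ u‖ ≤ (F₂ 0).re := by
      intro u
      have h1 : ‖G₁ u‖ ≤ (G₁ 0).re := norm_weilConv_weilReflect_le_re_zero hw₁t u
      have h2 : ‖G₂ u‖ ≤ (G₂ 0).re := norm_weilConv_weilReflect_le_re_zero hw₂t u
      have hm : ‖m‖ = η ^ 2 := by
        rw [hmdef, Complex.norm_real, Real.norm_eq_abs, abs_of_nonneg (sq_nonneg η)]
      rw [hF₂0]
      calc ‖F₂ u‖ = ‖F u + m * G₁ u + m * G₂ u‖ := rfl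
        _ ≤ ‖F u‖ + ‖m * G₁ u‖ + ‖m * G₂ u‖ := norm_add₃_le
        _ = ‖F u‖ + η ^ 2 * ‖G₁ u‖ + η ^ 2 * ‖G₂ u‖ := by rw [norm_mul, norm_mul, hm]
        _ ≤ (F 0).re + η ^ 2 * (G₁ 0).re + η ^ 2 * (G₂ 0).re := by
            gcongr
            exact hdom u
    -- node non-negativity
    have hn₂ : ∀ n : ℕ, 2 ≤ n → 0 ≤ (F₂ (Real.log n)).re := by
      intro n hn2
      simp only [hF₂def, hF₁def, hG₁node n hn2, hG₂node n hn2, mul_zero, add_zero]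
      exact hn n hn2
    -- the values at `c₁` and `c₂`
    have hre₁ : (F₂ c₁).re < 0 := by
      simp only [hF₂def, hF₁def, hFc₁, hG₂c₁, zero_add, mul_zero, add_zero, hmdef, Complex.re_ofReal_mul]
      exact mul_neg_of_pos_of_neg (pow_pos hη 2) hG₁c₁
    have hre₂ : (F₂ c₂).re < 0 := by
      simp only [hF₂def, hF₁def, hFc₂, hG₁c₂, zero_add, mul_zero, hmdef, Complex.re_ofReal_mul]
      exact mul_neg_of_pos_of_neg (pow_pos hη 2) hG₂c₂
    have habs₁ : Real.log 2 ≤ |c₁| := by rwa [abs_of_nonneg hc₁0]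
    have habs₂ : Real.log 2 ≤ |c₂| := by rwa [abs_of_nonneg hc₂0]
    -- oscillation, and NOT a single window
    have hosc₂ : ∃ t : ℝ, Real.log 2 ≤ |t| ∧ (F₂ t).re < 0 := ⟨c₁, habs₁, hre₁⟩
    have hnw₂ : ¬ ∃ T : ℝ, 3 ≤ T ∧ ∀ t : ℝ, Real.log 2 ≤ |t| → (F₂ t).re < 0 →
        T ≤ |t| ∧ |t| ≤ T + Real.log 2 := by
      rintro ⟨T, -, hT⟩
      have h₁ := hT c₁ habs₁ hre₁
      have h₂ := hT c₂ habs₂ hre₂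
      rw [abs_of_nonneg hc₁0] at h₁
      rw [abs_of_nonneg hc₂0] at h₂
      linarith [h₁.1, h₂.2]
    -- the core-class statement at `F₂`, in the Literature vocabulary (definitional unfolding)
    have step : -(F₂ 0).re ≤ (weilPolarTerm F₂ + weilArchTerm F₂).re :=
      h a' ha' ha'13 F₂ ⟨hF₂t, hF₂supp⟩ hherm₂ hdom₂ hn₂ hnw₂ hosc₂
    have e₁ : weilPolarTerm F₁ + weilArchTerm F₁ =
        (weilPolarTerm F + weilArchTerm F) + m * (weilPolarTerm G₁ + weilArchTerm G₁) :=
      weilArchPolar_add_const_mul hFt hG₁t m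
    have e₂ : weilPolarTerm F₂ + weilArchTerm F₂ =
        (weilPolarTerm F₁ + weilArchTerm F₁) + m * (weilPolarTerm G₂ + weilArchTerm G₂) :=
      weilArchPolar_add_const_mul hF₁t hG₂t m
    rw [e₂, e₁, hF₂0] at step
    simp only [hmdef, Complex.add_re, Complex.re_ofReal_mul] at step
    simp only [Complex.add_re]
    linear_combination step
  exact le_of_forall_pos_le_add_sq_mul key

/-! ## The negative lemmas -/

/-- **Origin domination does not rescue positive-definiteness on the coherent-core class.** The crux
`OscCoherentCore` with its cone structure "`F = Σᵢ gᵢ ⋆ g̃ᵢ`, `supp gᵢ ⊆ [-a, a]`" replaced by "`F` smooth,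
compactly supported in `[-2a, 2a]`, hermitian AND origin-dominating (`‖F u‖ ≤ Re F(0)`)" — cutoff guard
`13/10 < a`, node hypothesis, "not a single window", oscillation hypothesis and conclusion verbatim — is FALSE
(transfer + the parent's plateau-comb witness `signConeOscillatory_false_without_PD_originDominating`). [folklore] -/
theorem oscCoherentCore_false_without_PD_originDominating :
    ¬ (∀ a : ℝ, 0 < a → 13 / 10 < a → ∀ F : ℝ → ℂ,
      (ContDiff ℝ ((⊤ : ℕ∞) : WithTop ℕ∞) F ∧ HasCompactSupport F) ∧ tsupport F ⊆ Set.Icc (-(2 * a)) (2 * a) →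
      (∀ u : ℝ, F (-u) = (starRingEnd ℂ) (F u)) → (∀ u : ℝ, ‖F u‖ ≤ (F 0).re) →
      (∀ n : ℕ, 2 ≤ n → 0 ≤ (F (Real.log n)).re) →
      ¬ (∃ T : ℝ, 3 ≤ T ∧ ∀ t : ℝ, Real.log 2 ≤ |t| → (F t).re < 0 → T ≤ |t| ∧ |t| ≤ T + Real.log 2) →
      (∃ t : ℝ, Real.log 2 ≤ |t| ∧ (F t).re < 0) →
      let M : ℂ → ℂ := fun s => ∫ u : ℝ, F u * Complex.exp ((s - 1 / 2) * u);
      -(F 0).re ≤ (M 0 + M 1 + ((1 / (2 * Real.pi) : ℂ) * (∫ t : ℝ, M (1 / 2 + t * Complex.I) *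
        ((Complex.digamma (1 / 4 + t / 2 * Complex.I)).re : ℂ)) - F 0 * (Real.log Real.pi : ℂ))).re) :=
  fun h => signConeOscillatory_false_without_PD_originDominating (withoutPD_originDominating_transfer h)

/-- **Positive-definiteness is load-bearing for `OscCoherentCore`.** The crux with its cone structure replaced by
"`F` smooth, compactly supported in `[-2a, 2a]`, hermitian" — cutoff guard `13/10 < a`, node hypothesis, "not a
single window", oscillation hypothesis and conclusion verbatim — is FALSE (a fortiori from the origin-dominating
version). [folklore] -/
theorem oscCoherentCore_false_without_PD :
    ¬ (∀ a : ℝ, 0 < a → 13 / 10 < a → ∀ F : ℝ → ℂ,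
      (ContDiff ℝ ((⊤ : ℕ∞) : WithTop ℕ∞) F ∧ HasCompactSupport F) ∧ tsupport F ⊆ Set.Icc (-(2 * a)) (2 * a) →
      (∀ u : ℝ, F (-u) = (starRingEnd ℂ) (F u)) →
      (∀ n : ℕ, 2 ≤ n → 0 ≤ (F (Real.log n)).re) →
      ¬ (∃ T : ℝ, 3 ≤ T ∧ ∀ t : ℝ, Real.log 2 ≤ |t| → (F t).re < 0 → T ≤ |t| ∧ |t| ≤ T + Real.log 2) →
      (∃ t : ℝ, Real.log 2 ≤ |t| ∧ (F t).re < 0) →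
      let M : ℂ → ℂ := fun s => ∫ u : ℝ, F u * Complex.exp ((s - 1 / 2) * u);
      -(F 0).re ≤ (M 0 + M 1 + ((1 / (2 * Real.pi) : ℂ) * (∫ t : ℝ, M (1 / 2 + t * Complex.I) *
        ((Complex.digamma (1 / 4 + t / 2 * Complex.I)).re : ℂ)) - F 0 * (Real.log Real.pi : ℂ))).re) :=
  fun h => oscCoherentCore_false_without_PD_originDominating
    fun a ha ha13 F hF hherm _hdom hn hnw hosc => h a ha ha13 F hF hherm hn hnw hosc

end Summit.RiemannHypothesis.RiemannHypothesis.Theorems.OscCoherentCore.Negative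

end
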